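import Mathlib
import Summits.NavierStokesRegularity.NavierStokesRegularity.Theses.RootDecompStaticSkirt

/-!
# The EULER GAUGE cut of N25's jolting-skirt residual is exact (glue of the layer-2 split)

Route `RootDecompStaticSkirt` (decomp-ns node N25), item `NoJoltingSupercriticalSkirt` (LJ, stmt-33217) was split
(rev 1) by excluded middle on "the jolting supercritical skirt is tame-conical at its vertex" into
`NoTameConicalJoltingSkirt` (LJᶜ, stmt-33319) and `NoRogueJoltingSkirt` (LJʳ, stmt-33320), with the glue item
`NoJoltingSupercriticalSkirt_of_cells : LJᶜ → LJʳ → LJ` (stmt-33321). This file proves the glue item (pure logic: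
LJʳ says every jolting supercritical skirt of a tame first blow-up is tame-conical, LJᶜ says a tame-conical one is
absurd), and records the converse restrictions, so the split is EXACT: `LJ ↔ LJᶜ ∧ LJʳ`
(lens-6 g14 `EulerGauge.lean` K3 `noJolting_iff_cells`).
-/

namespace Summit.NavierStokesRegularity.NavierStokesRegularity.Theorems

open Summit.NavierStokesRegularity.NavierStokesRegularity.Theses.RootDecompStaticSkirt

/-- The glue item of the EULER GAUGE split, proved: `NoTameConicalJoltingSkirt → NoRogueJoltingSkirt →
NoJoltingSupercriticalSkirt`. -/
theorem rootDecompStaticSkirt_noJoltingSupercriticalSkirt_of_cells_proof :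
    Summit.NavierStokesRegularity.NavierStokesRegularity.Theses.RootDecompStaticSkirt.NoJoltingSupercriticalSkirt_of_cells := by
  intro hC hR ν T hν hT u p hmax hLH hdec htend x₀ r hs hj
  exact hC ν T hν hT u p hmax hLH hdec htend x₀ r hs hj (hR ν T hν hT u p hmax hLH hdec htend x₀ r hs hj)

/-- Converse restriction 1: LJ ⟹ LJᶜ. -/
theorem rootDecompStaticSkirt_noTameConicalJoltingSkirt_of_noJolting
    (h : NoJoltingSupercriticalSkirt) : NoTameConicalJoltingSkirt :=
  fun ν T hν hT u p hmax hLH hdec htend x₀ r hs hj _ => h ν T hν hT u p hmax hLH hdec htend x₀ r hs hj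

/-- Converse restriction 2: LJ ⟹ LJʳ. -/
theorem rootDecompStaticSkirt_noRogueJoltingSkirt_of_noJolting
    (h : NoJoltingSupercriticalSkirt) : NoRogueJoltingSkirt :=
  fun ν T hν hT u p hmax hLH hdec htend x₀ r hs hj => (h ν T hν hT u p hmax hLH hdec htend x₀ r hs hj).elim

/-- EXACTNESS of the split on the tree decls: `LJ ↔ LJᶜ ∧ LJʳ`. -/
theorem rootDecompStaticSkirt_noJolting_iff_cells :
    NoJoltingSupercriticalSkirt ↔ NoTameConicalJoltingSkirt ∧ NoRogueJoltingSkirt :=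
  ⟨fun h => ⟨rootDecompStaticSkirt_noTameConicalJoltingSkirt_of_noJolting h,
    rootDecompStaticSkirt_noRogueJoltingSkirt_of_noJolting h⟩,
    fun h => rootDecompStaticSkirt_noJoltingSupercriticalSkirt_of_cells_proof h.1 h.2⟩

end Summit.NavierStokesRegularity.NavierStokesRegularity.Theorems
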